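/-
certnum (FRONTIER certnum, D-0105 (6)) — L3/L4 worked-example module, landed by certnum-lean-1 for certnum-ode-1
(lead decision 2026-08-27T04:26:52Z).  KERNEL REPLAY of two `cap.ode` certificates (schema cap-ode-cert/2) as
elementary-field QR–Lohner doubleton chains; NOT a certification of any client number.
-/
import Literature.Analysis.ODE.ElementaryFieldDoubletonChainCertificate
import Literature.Computation.Certificates.CapOdeDoubletonReplaySwingStages
import HarnessLib

/-!
# Kernel replay of `cap.ode` doubleton certificates (format-level replay: cap-ode-cert/2 → `EDChainCert`)

HONEST FRAMING: this module is a WORKED EXAMPLE of a format-level replay — two certificates emitted by the engine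
`cap.ode` (schema `cap-ode-cert/2`: a `C¹`, autonomous, elementary field with exact rational parameters, an initial
box, a horizon `T`, per-step doubleton nodes and a claim box at `T`) are transcribed by certnum-ode-1's translator
`pub/certnum/certnum-ode-1/code/capcert2lean.py` (sha16 `3e31c8deb5d4154f`) into literal `EDChainCert` data of
`Literature.Analysis.ODE.ElementaryFieldDoubletonChainCertificate`, and the KERNEL re-decides them with the tree's
verifier `eDoubletonChainVerifier` (soundness theorem `EDChainCert.sound`, [MrozekZgliczynski2000, Lemma 8.5,
Theorem 7.5]; mean value form of the flow [Moore1979, §4.3 eq. (4.19)]; evaluation order [KapelaZgliczynski2009,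
§6.4]).  No new mathematics is stated here: every declaration is instance DATA or a theorem obtained by `decide +kernel`
and the existing soundness theorems; the provenance tags are those of the method the kernel applies.  The numbers belong
to the client cell that cites a theorem of this file; nothing here is a certnum release (pub/certnum/RELEASES.md).

CERTIFICATE KIND: cap-ode-cert/2 (producer `cap.ode` 0.3.2-cap3, order 6, float backend, kernel-friendly margins
`r_rel 1e-3 / r_abs 1e-9`) → `EDChainCert 2`; FIELDS: `system` text ↦ `…Field` (the translator's parse, parameters
substituted exactly), `box` ↦ `…Box`, `r0` ↦ `…R0`, `nodes[k]` ↦ `…Stages` / `…Final` (centre, `C`, `B`, `B⁻¹`, `[R]`;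
order, `h_k`, `W_k`, `Y_k`, `V_k`), `claim` ↦ `…Instance.final`, kernel precision ↦ `…Data.cfg`.
What the kernel re-decides per stage (`EDStage.stepCheck`, nine conjuncts, one `decide +kernel` each or one per stage):
the state and variational high-order enclosure tests over `W_k`, `W_k` non-degenerate, centre `∈ W_k`, the point
certificate of the centre, hull `⊆ W_k`, the exact inverse `Q′B′ = 1` in `ℚ`, and the `C¹`-Lohner rearrangement box
`⊆ [R′]`; then `C₀ = 1`, `0 ∈ [R₀]`, box `− c₀ ⊆ [R⁰]`, `Σ h_k = T` and final hull `⊆` claim box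
(`eDoubletonChainVerifier`).  Conclusion (`…_final`): every solution of the field on `[0, T]` from any point of the
initial box has `y(T)` in the claim box.

The two instances (instance 1 in THIS file — the client pub/gridfusion asked for the swing-model kernel leg, certnum-lead
04:30:33Z; instance 2 in the sibling module `CapOdeDoubletonReplayPendulum.lean`; instance 1's data and stages 0–3 in
`CapOdeDoubletonReplaySwingStages.lean`, imported here — split only because the gate elaborates one file within 600 s and a
stage check costs ≈ 70–80 s of kernel time)
* `smibK13FaultOnD…` — an affine planar field `d' = ω`, `ω' = (377/7)·(79912287/88791425) − (10/7)·ω` (the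
  fault-on leg of a single-machine-infinite-bus swing model supplied by the client cell pub/gridfusion as
  `request_SMIB-faulton.json`; the physical model is the client's and is not asserted here) from the box
  `[420253739949835307·2⁻⁵⁹, 840507479899670615·2⁻⁶⁰] × [0, 0]`, `T = 117/1000`, 8 stages (certificate
  `smibFaultOnD.json` canonical-JSON sha16 `a1c9d7d417cfa140`, file on disk `a9ea1d6a243ab1b1`; translator output
  `SmibK13FaultOnDReplay.lean` sha16
  `daecaafd293b9fca`): `(d, ω)(117/1000) ∈ [4697479808247777·2⁻⁵², 587184994874697·2⁻⁴⁹] ×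
  [2940033612974979·2⁻⁴⁹, 5880067276359275·2⁻⁵⁰]` (widths `3.4e-8`, `4.5e-8`).
* `pend2…` — the pendulum `x₁' = x₂`, `x₂' = −sin x₁` from the POINT `(1, 0)`, `T = 1/2`, 5 stages
  (certificate `pend2.json` canonical-JSON sha16 `62485668d3676bc1`, file on disk `d081e12756b978fb`; translator output
  `Pend2Replay.lean` sha16 `c9bba3fcf8fc60f2`):
  `x(1/2) ∈ [2017685894534797·2⁻⁵¹, 4035371869202623·2⁻⁵²] × [−3700864764163913·2⁻⁵³, −7401729130902509·2⁻⁵⁴]`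
  (widths `1.8e-8`, `2.2e-8`).  Compare the tree's own pendulum-from-a-box transcript
  `ElementaryFieldDoubletonChainCertificate.pendulumBoxDChain` (hand-written stages, `h = 1/8`).

Certificate hashes above are of the CANONICAL JSON (`sort_keys`, compact separators), as in certnum-ode-1's
evidence README; «kernel-checked» below = a Lean theorem with standard axioms (typed/WORDING.md), the numbers stay the
client's.  NOT COVERED: the hash of the certificate text and the translator's parse of the `cap-ode-expr/1` system string (the
`FExpr` literals below ARE the statement); the float producer; cap.ode's `D`-chain / Jacobian claims and sections;
non-autonomous fields, `atan`/`π`, interval parameters (translator v0 limits: order ≤ 6, `n ≤ 3`, ≤ ~10 stages per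
file); any statement about a physical system.  Kernel cost (farm, 2026-08-27): ≈ 30–90 s per stage at `n = 2`.
-/

open Set NonemptyInterval Matrix
open scoped Pointwise
open Literature.Analysis.ValidatedNumerics Literature.Analysis.ValidatedNumerics.ITaylor
open Literature.Analysis.ODE Literature.Analysis.ODE.FExpr

namespace Literature.Computation.Certificates.CapOdeDoubletonReplay

/-! ## Instance 1 (part 2): stages 4–7, the chain check, the verifier's claim and the enclosure at `T = 117/1000` -/

/-- stage 4 and the node it hands over to [cite: MrozekZgliczynski2000, Lemma 8.5] -/
def smibK13FaultOnDS4 : EDStage 2 := smibK13FaultOnDStages.getD 4 (EDStage.padOf smibK13FaultOnDR0)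
/-- The node that stage 4 hands over to (node 5 of the transcript, or the final node). [cite: MrozekZgliczynski2000, Lemma 8.5] -/
def smibK13FaultOnDN4 : DNode 2 := (smibK13FaultOnDStages.getD 5 (EDStage.padOf smibK13FaultOnDR0)).node

set_option maxHeartbeats 0 in
/-- stage 4: the C¹ step certificate (state HOE ∧ variational runs ∧ variational HOE), a-priori box non-degenerate, centre ∈ W, point certificate,
hull ⊆ W, exact inverse, rearrangement ⊆ [R′] — one `decide +kernel` per conjunct. [cite: MrozekZgliczynski2000, Lemma 8.5] -/
theorem smibK13FaultOnDS4_check : (smibK13FaultOnDS4).stepCheck smibK13FaultOnDField smibK13FaultOnDData.cfg smibK13FaultOnDR0 smibK13FaultOnDN4 = true := by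
  simp only [EDStage.stepCheck, EMVStepCert.check, EVarStepCert.check, Bool.and_eq_true]
  exact ⟨⟨⟨⟨⟨⟨⟨⟨by decide +kernel, by decide +kernel⟩, by decide +kernel⟩, by decide +kernel⟩, by decide +kernel⟩, by decide +kernel⟩,
    by decide +kernel⟩, by decide +kernel⟩, by decide +kernel⟩

/-- stage 5 and the node it hands over to [cite: MrozekZgliczynski2000, Lemma 8.5] -/
def smibK13FaultOnDS5 : EDStage 2 := smibK13FaultOnDStages.getD 5 (EDStage.padOf smibK13FaultOnDR0)
/-- The node that stage 5 hands over to (node 6 of the transcript, or the final node). [cite: MrozekZgliczynski2000, Lemma 8.5] -/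
def smibK13FaultOnDN5 : DNode 2 := (smibK13FaultOnDStages.getD 6 (EDStage.padOf smibK13FaultOnDR0)).node

set_option maxHeartbeats 0 in
/-- stage 5: the C¹ step certificate (state HOE ∧ variational runs ∧ variational HOE), a-priori box non-degenerate, centre ∈ W, point certificate,
hull ⊆ W, exact inverse, rearrangement ⊆ [R′] — one `decide +kernel` per conjunct. [cite: MrozekZgliczynski2000, Lemma 8.5] -/
theorem smibK13FaultOnDS5_check : (smibK13FaultOnDS5).stepCheck smibK13FaultOnDField smibK13FaultOnDData.cfg smibK13FaultOnDR0 smibK13FaultOnDN5 = true := by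
  simp only [EDStage.stepCheck, EMVStepCert.check, EVarStepCert.check, Bool.and_eq_true]
  exact ⟨⟨⟨⟨⟨⟨⟨⟨by decide +kernel, by decide +kernel⟩, by decide +kernel⟩, by decide +kernel⟩, by decide +kernel⟩, by decide +kernel⟩,
    by decide +kernel⟩, by decide +kernel⟩, by decide +kernel⟩

/-- stage 6 and the node it hands over to [cite: MrozekZgliczynski2000, Lemma 8.5] -/
def smibK13FaultOnDS6 : EDStage 2 := smibK13FaultOnDStages.getD 6 (EDStage.padOf smibK13FaultOnDR0)
/-- The node that stage 6 hands over to (node 7 of the transcript, or the final node). [cite: MrozekZgliczynski2000, Lemma 8.5] -/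
def smibK13FaultOnDN6 : DNode 2 := (smibK13FaultOnDStages.getD 7 (EDStage.padOf smibK13FaultOnDR0)).node

set_option maxHeartbeats 0 in
/-- stage 6: the C¹ step certificate (state HOE ∧ variational runs ∧ variational HOE), a-priori box non-degenerate, centre ∈ W, point certificate,
hull ⊆ W, exact inverse, rearrangement ⊆ [R′] — one `decide +kernel` per conjunct. [cite: MrozekZgliczynski2000, Lemma 8.5] -/
theorem smibK13FaultOnDS6_check : (smibK13FaultOnDS6).stepCheck smibK13FaultOnDField smibK13FaultOnDData.cfg smibK13FaultOnDR0 smibK13FaultOnDN6 = true := by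
  simp only [EDStage.stepCheck, EMVStepCert.check, EVarStepCert.check, Bool.and_eq_true]
  exact ⟨⟨⟨⟨⟨⟨⟨⟨by decide +kernel, by decide +kernel⟩, by decide +kernel⟩, by decide +kernel⟩, by decide +kernel⟩, by decide +kernel⟩,
    by decide +kernel⟩, by decide +kernel⟩, by decide +kernel⟩

/-- stage 7 and the node it hands over to [cite: MrozekZgliczynski2000, Lemma 8.5] -/
def smibK13FaultOnDS7 : EDStage 2 := smibK13FaultOnDStages.getD 7 (EDStage.padOf smibK13FaultOnDR0)
/-- The node that stage 7 hands over to (node 8 of the transcript, or the final node). [cite: MrozekZgliczynski2000, Lemma 8.5] -/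
def smibK13FaultOnDN7 : DNode 2 := smibK13FaultOnDFinal

set_option maxHeartbeats 0 in
/-- stage 7: the C¹ step certificate (state HOE ∧ variational runs ∧ variational HOE), a-priori box non-degenerate, centre ∈ W, point certificate,
hull ⊆ W, exact inverse, rearrangement ⊆ [R′] — one `decide +kernel` per conjunct. [cite: MrozekZgliczynski2000, Lemma 8.5] -/
theorem smibK13FaultOnDS7_check : (smibK13FaultOnDS7).stepCheck smibK13FaultOnDField smibK13FaultOnDData.cfg smibK13FaultOnDR0 smibK13FaultOnDN7 = true := by
  simp only [EDStage.stepCheck, EMVStepCert.check, EVarStepCert.check, Bool.and_eq_true]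
  exact ⟨⟨⟨⟨⟨⟨⟨⟨by decide +kernel, by decide +kernel⟩, by decide +kernel⟩, by decide +kernel⟩, by decide +kernel⟩, by decide +kernel⟩,
    by decide +kernel⟩, by decide +kernel⟩, by decide +kernel⟩

set_option maxHeartbeats 0 in
/-- **The kernel accepts the 8-stage transcript**: the chain recursion unrolled by `simp only`, each stage = its split theorem above.
[cite: MrozekZgliczynski2000, Lemma 8.5] -/
theorem smibK13FaultOnDChain_check : smibK13FaultOnDChain.check = true := by
  simp only [smibK13FaultOnDChain, EChainInstance.withEDStages, smibK13FaultOnDInstance, smibK13FaultOnDData, smibK13FaultOnDStages, EDChainCert.check, edChainCheck, edNext, Bool.and_true, Bool.and_eq_true]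
  exact ⟨smibK13FaultOnDS0_check, smibK13FaultOnDS1_check, smibK13FaultOnDS2_check, smibK13FaultOnDS3_check, smibK13FaultOnDS4_check, smibK13FaultOnDS5_check, smibK13FaultOnDS6_check, smibK13FaultOnDS7_check⟩

/-- The transcript has 8 steps. [cite: Moore1979, §8.1 eq. (8.13)] -/
theorem smibK13FaultOnDChain_size : smibK13FaultOnDChain.size = 8 := rfl

/-- Its horizon is T = 117/1000 exactly. [cite: Moore1979, §8.1 eq. (8.13)] -/
theorem smibK13FaultOnDChain_meshQ : smibK13FaultOnDChain.toHOEChain.meshQ 8 = (117/1000) := by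
  decide +kernel

/-- **The verifier's claim for the instance** (existence on [0, T] from every point of the box and y(T) ∈ claim box), from `eDoubletonChainVerifier.sound`.
[cite: MrozekZgliczynski2000, Lemma 8.5] -/
theorem smibK13FaultOnD_claim : smibK13FaultOnDInstance.Claim := by
  refine (eDoubletonChainVerifier 2).sound (c := smibK13FaultOnDData) ?_
  show (isOneQ (smibK13FaultOnDChain.nodeAt 0).cmat && boxLE (pointBox 0) (smibK13FaultOnDChain.nodeAt 0).rem &&
      boxLE (shiftBox smibK13FaultOnDInstance.init (smibK13FaultOnDChain.nodeAt 0).center) smibK13FaultOnDData.r0 &&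
        decide (smibK13FaultOnDChain.toHOEChain.meshQ smibK13FaultOnDData.stages.length =
          smibK13FaultOnDInstance.horizon) &&
          smibK13FaultOnDChain.check && boxLE smibK13FaultOnDChain.finalHull smibK13FaultOnDInstance.final) = true
  rw [smibK13FaultOnDChain_check, Bool.and_true, Bool.and_eq_true, Bool.and_eq_true]
  exact ⟨⟨by decide +kernel, decide_eq_true smibK13FaultOnDChain_meshQ⟩, by decide +kernel⟩

/-- **Kernel-checked enclosure at T**: every solution of the field from any point of the initial box on [0, T] has y(T) in the certificate's claim box.
[cite: Moore1979, §8.1 eq. (8.13)] [cite: MrozekZgliczynski2000, Lemma 8.5] -/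
theorem smibK13FaultOnD_final {y₀ : Fin 2 → ℝ} (hy₀ : y₀ ∈ boxSet (castBox smibK13FaultOnDBox))
    {z : ℝ → Fin 2 → ℝ} (hz0 : z 0 = y₀)
    (hz : ∀ t ∈ Icc (0 : ℝ) (117/1000), HasDerivWithinAt z (fieldFun smibK13FaultOnDField (z t)) (Icc (0 : ℝ) (117/1000)) t) :
    z (117/1000) ∈ boxSet (castBox smibK13FaultOnDInstance.final) := by
  have h := (smibK13FaultOnD_claim y₀ hy₀).2 z hz0
  have hT : ((smibK13FaultOnDInstance.horizon : ℚ) : ℝ) = (117/1000) := by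
    show ((((117/1000) : ℚ)) : ℝ) = (117/1000)
    norm_num
  rw [hT] at h
  exact h hz

end Literature.Computation.Certificates.CapOdeDoubletonReplay
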